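import Literature.AnabelianGeometry.SemiGraphs.ArithmeticCoverings
import HarnessLib

/-!
# [SemiAnbd] Thm 5.4 (iii): "arithmetically quasi-geometric", the COMPATIBLE reading (additive companion;
# row T54-7c (R1), finding W4d083-F2 — the χ2 twin of `IsArithQuasiGeometric` / clause 3)

Mochizuki, *Semi-graphs of anabelioids*, Publ. RIMS **42** (2006), §5, Theorem 5.4 (iii), manuscript
p. 66 [cite: MochizukiSemiAnbd2006, Thm 5.4 (iii), p. 66]: "arithmetically quasi-geometric if the
homomorphism … maps any arithmetically maximal compact subgroup `K₁ ⊆ Π^temp_𝔊` (respectively,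
arithmetically ample intersection `K₁ ∩ H₁` of two distinct arithmetically maximal compact subgroups
`K₁, H₁ ⊆ Π^temp_𝔊`) to an open subgroup of some arithmetically maximal compact subgroup `K₂ ⊆ Π^temp_ℍ`
(respectively, of some arithmetically ample intersection `K₂ ∩ H₂` of two distinct arithmetically maximal
compact subgroups `K₂, H₂ ⊆ Π^temp_ℍ`) … the proofs are entirely parallel to those of Theorem 3.7,
Corollary 3.9"; §3, Definition 3.8 p. 42 [cite: MochizukiSemiAnbd2006, Def 3.8 p.42] (the geometric
prototype) and its COMPATIBLE reading `IsCompatiblyQuasiGeometric` (abc-iut-L3-t2,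
`TemperedQuasiGeometricCompatible.lean`; cell ruling χ2, findings t2g2-F1 / W4d083-F1).

DEFINITION file, statement-only lane (defs + `Iff.rfl` unfoldings; the projections / constructor /
assembly shape are in the proof-only companion `ArithQuasiGeometricCompatProofs.lean`) (cell abc-iut, layer L3, L3-lead rulings α14-1 (b) / α16-5 «T54-7c (R1) typer», seat
abc-iut-w4-d083; review lane).  FINDING W4d083-F2: the frozen `IsArithQuasiGeometric` (abc-iut-L3-t3,
`ArithMaximalCompact.lean`, imported NOT edited) renders print LITERALLY — its 4th conjunct provides a pair
`K₂ ≠ H₂` with `f(K₁ ∩ H₁)` open in `K₂ ∩ H₂` but does NOT say that `K₁` goes into `K₂` and `H₁` into `H₂`;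
exactly as for Def. 3.8, the "fold" (the arithmetic double of one vertex along one arithmetically estranged
branch, folded) satisfies the literal condition and is induced by no morphism of arithmetic semi-graphs of
anabelioids, so clause 3 (surjectivity) of the frozen `ArithQuasiGeometricCorrespondenceStatement`
(`ArithmeticCoverings.lean`, untouched) is suspect-not-derivable at such data (negative knowledge O-T54-1).
Here, ADDITIVELY: `IsArithCompatiblyQuasiGeometric` := the literal condition ∧ the compatibility clause
(distinct arithmetically maximal compact `K₁ ≠ H₁` with arithmetically ample `K₁ ∩ H₁` go into DISTINCT
arithmetically maximal compact `K₂ ≠ H₂`, RESPECTIVELY), and `ArithQuasiGeometricCorrespondenceStatementCompat`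
:= the frozen statement with "arithmetically quasi-geometric" read compatibly in clauses 1 and 3 (clause 1
becomes STRONGER than print — the arithmetic R0′; clause 3 becomes the provable surjectivity —
abc-iut-w5-d141's `Thm54iii.clause3Compat_of_geometric`, `ArithQuasiGeometricSurjectiveCompat.lean`).  Both
are predicates on explicit data, asserted nowhere; the literal defs stay (OPEN-AS-TYPED).  No instance, no
notation.  Nothing here bears on [IUTchIII] Cor. 3.12; typed ≠ proved.
-/

namespace Literature.AnabelianGeometry.SemiGraphs

open _root_.CategoryTheory

universe u v w uG uH uP

/-! ### The compatible reading of "arithmetically quasi-geometric" -/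

section QuasiGeometric

variable {Gtp : Type uG} [Group Gtp] [TopologicalSpace Gtp]
variable {Htp : Type uH} [Group Htp] [TopologicalSpace Htp]
variable {PA : Type uP} [Group PA] [TopologicalSpace PA]

/-- **"Arithmetically quasi-geometric", COMPATIBLE reading** (χ2 twin of the frozen `IsArithQuasiGeometric`,
[SemiAnbd] Thm 5.4 (iii) p. 66 read as Def. 3.8 p. 42 is read by `IsCompatiblyQuasiGeometric`): the literal
condition AND — the clause the literal rendering lacks — two DISTINCT arithmetically maximal compact subgroups
`K₁ ≠ H₁` of `Π^temp_𝔊` with arithmetically ample intersection are carried INTO two DISTINCT arithmetically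
maximal compact subgroups `K₂ ≠ H₂` of `Π^temp_ℍ`, respectively.
[cite: MochizukiSemiAnbd2006, Thm 5.4 (iii), p. 66] -/
def IsArithCompatiblyQuasiGeometric (augG : Gtp →* PA) (augH : Htp →* PA) (φ : Gtp →* Htp) : Prop :=
  IsArithQuasiGeometric augG augH φ ∧
    ∀ K₁ H₁ : Subgroup Gtp, IsArithMaximalCompact augG K₁ → IsArithMaximalCompact augG H₁ →
      K₁ ≠ H₁ → IsArithAmple augG (K₁ ⊓ H₁) →
        ∃ K₂ H₂ : Subgroup Htp, IsArithMaximalCompact augH K₂ ∧ IsArithMaximalCompact augH H₂ ∧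
          K₂ ≠ H₂ ∧ K₁.map φ ≤ K₂ ∧ H₁.map φ ≤ H₂

/-- Unfolding: the compatible reading is, definitionally, the literal condition together with the
compatibility clause (the inline hypothesis of abc-iut-w5-d141's `Thm54iii.clause3Compat_of_geometric`,
verbatim). [cite: MochizukiSemiAnbd2006, Thm 5.4 (iii), p. 66] -/
theorem isArithCompatiblyQuasiGeometric_iff (augG : Gtp →* PA) (augH : Htp →* PA) (φ : Gtp →* Htp) :
    IsArithCompatiblyQuasiGeometric augG augH φ ↔
      IsArithQuasiGeometric augG augH φ ∧
        ∀ K₁ H₁ : Subgroup Gtp, IsArithMaximalCompact augG K₁ → IsArithMaximalCompact augG H₁ →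
          K₁ ≠ H₁ → IsArithAmple augG (K₁ ⊓ H₁) →
            ∃ K₂ H₂ : Subgroup Htp, IsArithMaximalCompact augH K₂ ∧ IsArithMaximalCompact augH H₂ ∧
              K₂ ≠ H₂ ∧ K₁.map φ ≤ K₂ ∧ H₁.map φ ≤ H₂ :=
  Iff.rfl

end QuasiGeometric

/-! ### Theorem 5.4 (iii), compatible reading — statement over explicit inputs -/

section Thm54iii

variable {Obj : Type u} [Category.{v} Obj] {𝓥 : SemiAnbdVocab.{u, v, w} Obj}
variable (𝔊 ℍ : ArithSemiGraph 𝓥) (e : 𝔊.PA ≃* ℍ.PA)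
variable {Gtp : Type uG} [Group Gtp] [TopologicalSpace Gtp]
variable {Htp : Type uH} [Group Htp] [TopologicalSpace Htp]

/-- **Thm 5.4 (iii), COMPATIBLE reading** (χ2 twin of the frozen `ArithQuasiGeometricCorrespondenceStatement`,
same explicit data: the augmentations `augG`, `augH` to `Π_A`, the identification `e`, and the map "apply
`B^temp(−)`" `btemp`): (1) `B^temp(φ)` of a locally open `φ : 𝔊 → ℍ` over `A` is arithmetically
COMPATIBLY quasi-geometric over `A^⊤` [STRONGER than print's clause 1 — the arithmetic R0′]; (2) verbatim:
two such `φ`, `ψ` are equivalent under the inner action (Def 5.1 (iv)) iff `B^temp(ψ)` is an inner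
conjugate of `B^temp(φ)`; (3) every arithmetically COMPATIBLY quasi-geometric `f : Π^temp_𝔊 → Π^temp_ℍ`
over `A^⊤` is an inner conjugate of some `B^temp(φ)` [the provable surjectivity; the literal clause 3 is
suspect-not-derivable at fold data, O-T54-1].  Not asserted for arbitrary data.
[cite: MochizukiSemiAnbd2006, Thm 5.4 (iii), p. 66] -/
def ArithQuasiGeometricCorrespondenceStatementCompat (augG : Gtp →* 𝔊.PA) (augH : Htp →* ℍ.PA)
    (btemp : (φ : ArithHom 𝓥 𝔊 ℍ) → φ.IsLocallyOpen → ArithHom.IsOverA 𝔊 ℍ e φ → (Gtp →* Htp)) :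
    Prop :=
  let augH' : Htp →* 𝔊.PA := e.symm.toMonoidHom.comp augH
  (∀ (φ : ArithHom 𝓥 𝔊 ℍ) (h₁ : φ.IsLocallyOpen) (h₂ : ArithHom.IsOverA 𝔊 ℍ e φ),
      IsArithCompatiblyQuasiGeometric augG augH' (btemp φ h₁ h₂)) ∧
    (∀ (φ ψ : ArithHom 𝓥 𝔊 ℍ) (h₁ : φ.IsLocallyOpen) (h₂ : ArithHom.IsOverA 𝔊 ℍ e φ)
        (k₁ : ψ.IsLocallyOpen) (k₂ : ArithHom.IsOverA 𝔊 ℍ e ψ),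
      ArithHom.InnerEquiv φ ψ ↔
        ∃ h : Htp, ∀ g, btemp ψ k₁ k₂ g = h * btemp φ h₁ h₂ g * h⁻¹) ∧
    ∀ f : Gtp →* Htp, IsArithCompatiblyQuasiGeometric augG augH' f →
      ∃ (φ : ArithHom 𝓥 𝔊 ℍ) (h₁ : φ.IsLocallyOpen) (h₂ : ArithHom.IsOverA 𝔊 ℍ e φ) (h : Htp),
        ∀ g, f g = h * btemp φ h₁ h₂ g * h⁻¹

/-- Unfolding: the compatible statement is, definitionally, the conjunction of its three clauses (with
`augH' := e⁻¹ ∘ augH` substituted). [cite: MochizukiSemiAnbd2006, Thm 5.4 (iii), p. 66] -/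
theorem arithQuasiGeometricCorrespondenceStatementCompat_iff (augG : Gtp →* 𝔊.PA) (augH : Htp →* ℍ.PA)
    (btemp : (φ : ArithHom 𝓥 𝔊 ℍ) → φ.IsLocallyOpen → ArithHom.IsOverA 𝔊 ℍ e φ → (Gtp →* Htp)) :
    ArithQuasiGeometricCorrespondenceStatementCompat 𝔊 ℍ e augG augH btemp ↔
      (∀ (φ : ArithHom 𝓥 𝔊 ℍ) (h₁ : φ.IsLocallyOpen) (h₂ : ArithHom.IsOverA 𝔊 ℍ e φ),
          IsArithCompatiblyQuasiGeometric augG (e.symm.toMonoidHom.comp augH) (btemp φ h₁ h₂)) ∧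
        (∀ (φ ψ : ArithHom 𝓥 𝔊 ℍ) (h₁ : φ.IsLocallyOpen) (h₂ : ArithHom.IsOverA 𝔊 ℍ e φ)
            (k₁ : ψ.IsLocallyOpen) (k₂ : ArithHom.IsOverA 𝔊 ℍ e ψ),
          ArithHom.InnerEquiv φ ψ ↔
            ∃ h : Htp, ∀ g, btemp ψ k₁ k₂ g = h * btemp φ h₁ h₂ g * h⁻¹) ∧
        ∀ f : Gtp →* Htp, IsArithCompatiblyQuasiGeometric augG (e.symm.toMonoidHom.comp augH) f →
          ∃ (φ : ArithHom 𝓥 𝔊 ℍ) (h₁ : φ.IsLocallyOpen) (h₂ : ArithHom.IsOverA 𝔊 ℍ e φ) (h : Htp),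
            ∀ g, f g = h * btemp φ h₁ h₂ g * h⁻¹ :=
  Iff.rfl

end Thm54iii

end Literature.AnabelianGeometry.SemiGraphs
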